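import Literature.Geometry.DiscreteGeometry.KissingCertComp
import Literature.Geometry.DiscreteGeometry.ThreePointKernelP
import Literature.Geometry.DiscreteGeometry.ThreePointBound

/-!
# Soundness of the certificate checker for the three-point bound on `S³`

The semantics of the kernel-evaluable checker of `KissingCertComp` for a Bachoc–Vallentin
certificate for the kissing number in four dimensions (BV 2008, Theorem 4.2 with `n = 4`,
`d = N = 7`): evaluation lemmas for every reflective construction, and the proof that a
successful check implies the two polynomial constraints `(i')`, `(ii')` of `card_le_of_threePoint`:

* `A(u) = Σ_k a_k U_k(u) / 2^S` with `a_k ≥ 0` (two-point part, `pairSum ≥ 0` by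
  `sum_sum_chebU_inner_nonneg`);
* `F(u,v,t) = Σ_k Σ_w sym6 (φ_w(u) φ_w(v) QkP k u v t) / 4^{S'}` with integer weight vectors `w`
  (three-point part, `tripleSum ≥ 0` by `sum_sum_QkP_nonneg`, symmetric by construction);
* `(i')`: `2^{2S''}·(-1 - A(s) - 2b₁₂ - b₂₂ - 3F(s,s,1)) = zᵀ(LLᵀ)z + (1+s)(1-2s) zᵀ(L₁L₁ᵀ)z + c₀ + ρ(s)`
  with `Σ|ρ_m| ≤ c₀`, checked on integer polynomials;
* `(ii')`: `2^{2S''}·(-b₂₂ - F) = zᵀG₀z + Σ_{x∈{u,v,t}} (1+x)(1-2x) zᵀG_x z + (1+2uvt-u²-v²-t²) zᵀG₄z + c₀ + ρ`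
  with every `G = LLᵀ` and `Σ|ρ_m| ≤ c₀`.

The expensive polynomial expansions (`F` from its blocks, and each `zᵀ(LLᵀ)z` from its integer
factor `L`) are supplied as data (`CertPolys`) and validated separately — block-chunked
`FchunkOK`/`FexpValid` for `F`, row-chunked `chunkOK`/`QuadOK3` for the Gram forms — so that
every kernel computation (`decide`) stays small; `checkI`/`checkII` then only combine the
validated expansions.

Main result: `card_le_of_cert` — if both checks succeed then every `π/3`-code `C ⊂ S³` has
`|C| ≤ 1 + A(1) + b₁₁ + F(1,1,1)`, the right-hand side being a kernel-computable rational;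
`card_le_24_of_cert` adds the numerical check `bound < 25`.

## References
* C. Bachoc, F. Vallentin, *New upper bounds for kissing numbers from semidefinite programming*,
  J. Amer. Math. Soc. 21 (2008), Theorem 4.2, §5. [`BachocVallentin2007`]
-/

noncomputable section

open scoped RealInnerProductSpace

namespace Literature.Geometry.DiscreteGeometry

open PolyCert PolyCert.SPoly

/-- Local notation for `ℝ⁴ = EuclideanSpace ℝ (Fin 4)`. -/
local notation "E⁴" => EuclideanSpace ℝ (Fin 4)

namespace PolyCert

/-! ### Sorted normalisation through an MSB-first trie -/

namespace CTree

/-- `insM` adds the value of the inserted term. [folklore] -/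
theorem eval_insM (d key : ℕ) (m : Mono) (c : ℤ) (tr tr' : CTree) (u v t : ℝ)
    (h : insM d key m c tr = some tr') : tr'.eval u v t = tr.eval u v t + (c : ℝ) * m.eval u v t := by
  induction d generalizing key tr tr' with
  | zero =>
    cases tr with
    | empty => simp [insM] at h; subst h; simp [eval]
    | leaf m' c' =>
      simp only [insM] at h
      by_cases hm : m = m'
      · rw [if_pos hm] at h; simp at h; subst h; subst hm; simp only [eval]; push_cast; ring
      · rw [if_neg hm] at h; simp at h
    | node l r => simp [insM] at h
  | succ d ih =>
    cases tr with
    | leaf m' c' => simp [insM] at h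
    | empty =>
      simp only [insM] at h
      split_ifs at h with hk
      · obtain ⟨l, hl, rfl⟩ := Option.map_eq_some_iff.1 h
        simp [eval, ih _ _ _ hl]
      · obtain ⟨r, hr, rfl⟩ := Option.map_eq_some_iff.1 h
        simp [eval, ih _ _ _ hr]
    | node l r =>
      simp only [insM] at h
      split_ifs at h with hk
      · obtain ⟨l', hl, rfl⟩ := Option.map_eq_some_iff.1 h
        simp [eval, ih _ _ _ hl]; ring
      · obtain ⟨r', hr, rfl⟩ := Option.map_eq_some_iff.1 h
        simp [eval, ih _ _ _ hr]; ring

/-- `insAllM` preserves the value. [folklore] -/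
theorem eval_insAllM (p : SPoly) (tr tr' : CTree) (u v t : ℝ) (h : insAllM p tr = some tr') :
    tr'.eval u v t = tr.eval u v t + SPoly.eval p u v t := by
  induction p generalizing tr tr' with
  | nil => simp [insAllM] at h; subst h; simp
  | cons mc rest ih =>
    obtain ⟨m, c⟩ := mc
    simp only [insAllM] at h
    split at h
    · simp at h
    · rename_i tr'' htr''
      rw [ih _ _ h, eval_insM _ _ _ _ _ _ _ _ _ htr'', SPoly.eval_cons]
      ring

/-- `toSPoly` preserves the value. [folklore] -/
theorem eval_toSPoly (tr : CTree) (u v t : ℝ) : SPoly.eval tr.toSPoly u v t = tr.eval u v t := by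
  induction tr with
  | empty => simp [toSPoly, eval]
  | leaf m c => simp [toSPoly, eval]
  | node l r ihl ihr => simp [toSPoly, eval, ihl, ihr]

end CTree

namespace SPoly

/-- `normalize` preserves the value. [folklore] -/
@[simp] theorem eval_normalize (p : SPoly) (u v t : ℝ) : eval (normalize p) u v t = eval p u v t := by
  unfold normalize
  split
  · rename_i tr h
    rw [CTree.eval_toSPoly, CTree.eval_insAllM p _ tr u v t h]; simp [CTree.eval]
  · rfl

/-- `mulN` is multiplication. [folklore] -/
@[simp] theorem eval_mulN (p q : SPoly) (u v t : ℝ) : eval (mulN p q) u v t = eval p u v t * eval q u v t := by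
  unfold mulN
  rw [eval_mergeAll, List.map_map]
  induction p with
  | nil => simp
  | cons mc p ih =>
    simp only [List.map_cons, List.sum_cons, Function.comp] at *
    rw [ih, eval_mulMono, eval_cons]; ring

/-- `eval p 1 1 1 = coeffSum p`. [folklore] -/
theorem eval_one_one_one (p : SPoly) : eval p 1 1 1 = coeffSum p := by
  induction p with
  | nil => simp [coeffSum]
  | cons mc p ih =>
    simp only [coeffSum, List.map_cons, List.sum_cons, Int.cast_add] at *
    rw [eval_cons, ih]; simp [Mono.eval]

/-! ### Reflective special polynomials -/

/-- `eval` of `chebUhPoly`. [folklore] -/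
theorem eval_chebUhPoly (k : ℕ) (Tp Dp : SPoly) (u v t : ℝ) :
    eval (chebUhPoly k Tp Dp) u v t = chebUh k (eval Tp u v t) (eval Dp u v t) := by
  induction k using Nat.twoStepInduction with
  | zero => simp [chebUhPoly]
  | one => simp [chebUhPoly]
  | more k ih0 ih1 =>
    rw [chebUhPoly, eval_normalize, eval_append, eval_mulN, eval_neg, eval_mulN, ih0, ih1,
      chebUh_add_two]
    ring

/-- `eval (chebUPoly k) = U_k(u)`. [folklore] -/
theorem eval_chebUPoly (k : ℕ) (u v t : ℝ) : eval (chebUPoly k) u v t = chebU k u := by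
  rw [chebUPoly, eval_normalize, eval_chebUhPoly, chebU]; simp

/-- `eval` of `legendreIPoly`. [folklore] -/
theorem eval_legendreIPoly (k : ℕ) (Sp Qp : SPoly) (u v t : ℝ) :
    eval (legendreIPoly k Sp Qp) u v t = legendreI k (eval Sp u v t) (eval Qp u v t) := by
  rw [legendreIPoly, eval_lsum, List.map_map, legendreI]
  rw [← list_sum_map_range]
  congr 1
  refine List.map_congr_left fun j _ => ?_
  simp only [Function.comp, eval_smul, eval_mul, eval_pow]
  push_cast; ring

/-- `eval (QkPPoly k) = QkP k`. [folklore] -/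
theorem eval_QkPPoly (k : ℕ) (u v t : ℝ) : eval (QkPPoly k) u v t = QkP k u v t := by
  rw [QkPPoly, eval_normalize, eval_legendreIPoly, QkP]
  simp; ring_nf

/-- `eval` of `baseTab`. [folklore] -/
theorem eval_baseTab (k a b : ℕ) (u v t : ℝ) :
    eval (baseTab k a b) u v t = u ^ a * v ^ b * QkP k u v t := by
  rw [baseTab, eval_normalize, eval_mulN, eval_QkPPoly]; simp [eval, Mono.eval]

/-- `eval` of `symTab`. [folklore] -/
theorem eval_symTab (k a b : ℕ) (u v t : ℝ) :
    eval (symTab k a b) u v t = sym6 (fun u v t => u ^ a * v ^ b * QkP k u v t) u v t := by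
  simp only [symTab, eval_normalize, eval_append, eval_permBAC, eval_permACB, eval_permCBA,
    eval_permCAB, eval_permBCA, eval_baseTab, sym6]

end SPoly

end PolyCert

/-! ### The three-point part `F` -/

/-- `φ_w(u) = Σ_{a < |w|} w_a u^a`. [folklore] -/
def phiW (w : List ℤ) (u : ℝ) : ℝ := ∑ a ∈ Finset.range w.length, (w.getD a 0 : ℝ) * u ^ a

/-- The `Y`-form with an arbitrary weight function. [cite: BachocVallentin2007, Theorem 3.2] -/
def YP (k : ℕ) (φ : ℝ → ℝ) (u v t : ℝ) : ℝ := φ u * φ v * QkP k u v t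

/-- Three-point positivity of `YP` (weights are arbitrary functions of `z·x`).
[cite: BachocVallentin2007, Corollary 3.5] -/
theorem tripleSum_YP_nonneg (k : ℕ) (φ : ℝ → ℝ) (C : Finset E⁴)
    (hC : ∀ x ∈ C, ‖x‖ = 1) : 0 ≤ tripleSum C (YP k φ) := by
  unfold tripleSum
  refine Finset.sum_nonneg fun z hz => ?_
  have h := sum_sum_QkP_nonneg k z (hC z hz) C (fun x => φ (inner ℝ z x)) (fun x => x) hC
  simpa only [YP] using h

/-- `F(u,v,t) = Σ_blocks Σ_w sym6 (YP k φ_w) (u,v,t)` (integer units). [folklore] -/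
def Fval (bs : List FBlk) (u v t : ℝ) : ℝ :=
  (bs.map fun b => (b.ws.map fun w => sym6 (YP b.k (phiW w)) u v t).sum).sum

/-- `tripleSum` of a list-indexed sum of functions. [folklore] -/
theorem tripleSum_listSum {α : Type*} (C : Finset E⁴) (l : List α) (f : α → ℝ → ℝ → ℝ → ℝ) :
    tripleSum C (fun u v t => (l.map fun a => f a u v t).sum) = (l.map fun a => tripleSum C (f a)).sum := by
  induction l with
  | nil => simp [tripleSum]
  | cons a l ih =>
    simp only [List.map_cons, List.sum_cons]
    rw [← ih]
    simp only [tripleSum, Finset.sum_add_distrib]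

/-- **Positivity of the three-point part**: `tripleSum C F ≥ 0`. [cite: BachocVallentin2007, Corollary 3.5] -/
theorem tripleSum_Fval_nonneg (bs : List FBlk) (C : Finset E⁴)
    (hC : ∀ x ∈ C, ‖x‖ = 1) : 0 ≤ tripleSum C (Fval bs) := by
  unfold Fval
  rw [tripleSum_listSum]
  refine List.sum_nonneg ?_
  intro x hx
  rw [List.mem_map] at hx
  obtain ⟨b, _, rfl⟩ := hx
  rw [tripleSum_listSum]
  refine List.sum_nonneg ?_
  intro y hy
  rw [List.mem_map] at hy
  obtain ⟨w, _, rfl⟩ := hy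
  rw [tripleSum_sym6]
  exact mul_nonneg (by norm_num) (tripleSum_YP_nonneg b.k _ C hC)

/-- `F` is symmetric in its first two arguments. [folklore] -/
theorem Fval_swap12 (bs : List FBlk) (u v t : ℝ) : Fval bs u v t = Fval bs v u t := by
  unfold Fval
  congr 1; refine List.map_congr_left fun b _ => ?_
  congr 1; refine List.map_congr_left fun w _ => ?_
  exact sym6_swap12 _ u v t

/-- `F` is symmetric in its last two arguments. [folklore] -/
theorem Fval_swap23 (bs : List FBlk) (u v t : ℝ) : Fval bs u v t = Fval bs u t v := by
  unfold Fval
  congr 1; refine List.map_congr_left fun b _ => ?_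
  congr 1; refine List.map_congr_left fun w _ => ?_
  exact sym6_swap23 _ u v t

/-- Expansion of one block: `sym6 (YP k φ_w) = Σ_{a,b} w_a w_b sym6 (u^a v^b QkP k)`. [folklore] -/
theorem sym6_YP_phiW (k : ℕ) (w : List ℤ) (u v t : ℝ) :
    sym6 (YP k (phiW w)) u v t = ∑ a ∈ Finset.range w.length, ∑ b ∈ Finset.range w.length,
      ((w.getD a 0 * w.getD b 0 : ℤ) : ℝ) * sym6 (fun u v t => u ^ a * v ^ b * QkP k u v t) u v t := by
  have key : ∀ x y q : ℝ, phiW w x * phiW w y * q =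
      ∑ a ∈ Finset.range w.length, ∑ b ∈ Finset.range w.length,
        ((w.getD a 0 * w.getD b 0 : ℤ) : ℝ) * (x ^ a * y ^ b * q) := by
    intro x y q
    unfold phiW
    rw [Finset.sum_mul_sum, Finset.sum_mul]
    refine Finset.sum_congr rfl fun a _ => ?_
    rw [Finset.sum_mul]
    refine Finset.sum_congr rfl fun b _ => ?_
    push_cast; ring
  simp only [sym6, YP, key, ← Finset.sum_add_distrib]
  refine Finset.sum_congr rfl fun a _ => Finset.sum_congr rfl fun b _ => ?_
  ring

namespace PolyCert.SPoly

/-- `eval (FwPoly k w) = sym6 (YP k φ_w)`. [folklore] -/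
theorem eval_FwPoly (k : ℕ) (w : List ℤ) (u v t : ℝ) :
    eval (FwPoly k w) u v t = sym6 (YP k (phiW w)) u v t := by
  rw [FwPoly, eval_mergeAll, List.map_map, sym6_YP_phiW, ← list_sum_map_range]
  refine congrArg List.sum (List.map_congr_left fun a _ => ?_)
  simp only [Function.comp_apply]
  rw [eval_mergeAll, List.map_map, ← list_sum_map_range]
  refine congrArg List.sum (List.map_congr_left fun b' _ => ?_)
  simp only [Function.comp_apply]
  rw [eval_smul, eval_symTab]

/-- `eval` of one block. [folklore] -/
theorem eval_FbPoly (b : FBlk) (u v t : ℝ) :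
    eval (FbPoly b) u v t = (b.ws.map fun w => sym6 (YP b.k (phiW w)) u v t).sum := by
  rw [FbPoly, eval_mergeAll, List.map_map]
  refine congrArg List.sum (List.map_congr_left fun w _ => ?_)
  simp only [Function.comp_apply]
  rw [eval_FwPoly]

/-- `eval (FPoly bs) = Fval bs`. [folklore] -/
theorem eval_FPoly (bs : List FBlk) (u v t : ℝ) : eval (FPoly bs) u v t = Fval bs u v t := by
  rw [FPoly, eval_mergeAll, List.map_map, Fval]
  refine congrArg List.sum (List.map_congr_left fun b _ => ?_)
  simp only [Function.comp_apply]
  rw [eval_FbPoly]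

end PolyCert.SPoly

/-! ### The two-point part `A` -/

/-- `A(u) = Σ_{k<|as|} as_k · U_{k+1}(u)` (integer units). [folklore] -/
def Aval (as : List ℤ) (u : ℝ) : ℝ :=
  ∑ k ∈ Finset.range as.length, (as.getD k 0 : ℝ) * chebU (k + 1) u

/-- **Positivity of the two-point part**: `pairSum C A ≥ 0` for nonnegative coefficients and
degrees `≤ 9`. [cite: Musin2008, §3-C (3.1)] -/
theorem pairSum_Aval_nonneg (as : List ℤ) (hlen : as.length ≤ 9) (hpos : ∀ k, 0 ≤ as.getD k 0)
    (C : Finset E⁴) (hC : ∀ x ∈ C, ‖x‖ = 1) : 0 ≤ pairSum C (Aval as) := by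
  unfold pairSum Aval
  have e : ∀ x ∈ C, (∑ y ∈ C, ∑ k ∈ Finset.range as.length,
      (as.getD k 0 : ℝ) * chebU (k + 1) (inner ℝ x y)) =
      ∑ k ∈ Finset.range as.length, ∑ y ∈ C, (as.getD k 0 : ℝ) * chebU (k + 1) (inner ℝ x y) :=
    fun x _ => Finset.sum_comm
  rw [Finset.sum_congr rfl e, Finset.sum_comm]
  refine Finset.sum_nonneg fun k hk => ?_
  rw [Finset.mem_range] at hk
  have hk9 : k + 1 ≤ 9 := by omega
  have h := sum_sum_chebU_inner_nonneg (k + 1) hk9 C hC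
  have e2 : (∑ x ∈ C, ∑ y ∈ C, (as.getD k 0 : ℝ) * chebU (k + 1) (inner ℝ x y)) =
      (as.getD k 0 : ℝ) * ∑ x ∈ C, ∑ y ∈ C, chebU (k + 1) (inner ℝ x y) := by
    rw [Finset.mul_sum]; refine Finset.sum_congr rfl fun x _ => ?_; rw [Finset.mul_sum]
  rw [e2]
  exact mul_nonneg (by exact_mod_cast hpos k) h

namespace PolyCert.SPoly

/-- `eval (APoly as) u v t = Aval as u`. [folklore] -/
theorem eval_APoly (as : List ℤ) (u v t : ℝ) : eval (APoly as) u v t = Aval as u := by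
  unfold APoly Aval
  rw [eval_mergeAll, List.map_map, ← list_sum_map_range]
  refine congrArg List.sum (List.map_congr_left fun k _ => ?_)
  simp only [Function.comp_apply]
  rw [eval_smul, eval_chebUPoly]

/-! ### Balanced merging (logarithmic nesting depth for kernel evaluation) -/

/-- `mergePairs` preserves the total value. [folklore] -/
theorem sum_eval_mergePairs (u v t : ℝ) : ∀ (ps : List SPoly),
    ((mergePairs ps).map fun p => eval p u v t).sum = (ps.map fun p => eval p u v t).sum
  | [] => by simp [mergePairs]
  | [p] => by simp [mergePairs]
  | p :: q :: rest => by
    simp only [mergePairs, List.map_cons, List.sum_cons, eval_mergeAdd]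
    rw [sum_eval_mergePairs u v t rest]; ring

/-- `mergeAllB` evaluates to the sum. [folklore] -/
theorem eval_mergeAllB (k : ℕ) (ps : List SPoly) (u v t : ℝ) :
    eval (mergeAllB k ps) u v t = (ps.map fun p => eval p u v t).sum := by
  induction k generalizing ps with
  | zero => simp [mergeAllB]
  | succ k ih =>
    match ps with
    | [] => simp [mergeAllB]
    | [p] => simp [mergeAllB]
    | p :: q :: rest => rw [mergeAllB, ih, sum_eval_mergePairs u v t]

/-- Value of `quadMonoB` (same as `quadMono`). [folklore] -/
theorem eval_quadMonoB (G : List (List ℤ)) (z : List Mono) (n : ℕ) (u v t : ℝ) :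
    eval (quadMonoB G z n) u v t = ∑ i ∈ Finset.range n, ∑ j ∈ Finset.range n,
      (getEntry G i j : ℝ) * ((getMono z i).eval u v t * (getMono z j).eval u v t) := by
  rw [← eval_quadMono, quadMono, eval_mergeAll, quadMonoB, eval_mergeAllB]

/-! ### Gram blocks and the two checks -/

/-- Sums over a `zipWith` as `Finset.range` sums of `getD` entries. [folklore] -/
theorem sum_map_zipWith {α β γ : Type*} (f : α → β → γ) (g : γ → ℝ) (da : α) (db : β) :
    ∀ (a : List α) (b : List β), a.length = b.length →
      ((List.zipWith f a b).map g).sum =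
        ∑ i ∈ Finset.range a.length, g (f (a.getD i da) (b.getD i db))
  | [], [], _ => by simp
  | [], _ :: _, h => by simp at h
  | _ :: _, [], h => by simp at h
  | x :: a, y :: b, h => by
    simp only [List.length_cons, Nat.add_right_cancel_iff] at h
    rw [List.zipWith_cons_cons, List.map_cons, List.sum_cons, List.length_cons,
      Finset.sum_range_succ', sum_map_zipWith f g da db a b h]
    simp [add_comm]

/-- Rows are no longer than `maxLen`. [folklore] -/
theorem length_le_maxLen (L : List (List ℤ)) (row : List ℤ) (h : row ∈ L) : row.length ≤ maxLen L := by
  induction L with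
  | nil => simp at h
  | cons r rs ih =>
    simp only [maxLen, List.map_cons, List.foldr_cons] at *
    rcases List.mem_cons.1 h with rfl | h'
    · exact le_max_left _ _
    · exact (ih h').trans (le_max_right _ _)

/-- `getRow` rows are no longer than `maxLen`. [folklore] -/
theorem length_getRow_le (L : List (List ℤ)) (i : ℕ) : (getRow L i).length ≤ maxLen L := by
  simp only [getRow, List.getD_eq_getElem?_getD]
  cases h : L[i]? with
  | none => simp
  | some row =>
    simp only [Option.getD_some]
    exact length_le_maxLen L row (List.mem_iff_getElem?.2 ⟨i, h⟩)

/-- `dotAcc a b acc = acc + dotL a b`. [folklore] -/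
theorem dotAcc_eq (a b : List ℤ) (acc : ℤ) : dotAcc a b acc = acc + dotL a b := by
  induction a generalizing b acc with
  | nil => cases b <;> simp [dotAcc, dotL]
  | cons x a ih =>
    cases b with
    | nil => simp [dotAcc, dotL]
    | cons y b =>
      rw [dotAcc, ih]
      simp [dotL]; ring

/-- Value of `quadL` as a double sum. [folklore] -/
theorem eval_quadL (g : GramBlk) (h : g.lenOK = true) (u v t : ℝ) :
    eval (quadL g) u v t = ∑ i ∈ Finset.range g.z.length, ∑ j ∈ Finset.range g.z.length,
      (dotL (getRow g.L i) (getRow g.L j) : ℝ) * ((getMono g.z i).eval u v t * (getMono g.z j).eval u v t) := by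
  have hn : g.L.length = g.z.length := by simpa [GramBlk.lenOK] using h
  rw [quadL, quadZip, eval_mergeAllB]
  have hlen : (gramRows g.L).length = g.z.length := by simp [gramRows, hn]
  rw [sum_map_zipWith _ _ [] ⟨0, 0, 0⟩ _ _ hlen, hlen]
  refine Finset.sum_congr rfl fun i hi => ?_
  rw [Finset.mem_range] at hi
  have hrow : (gramRows g.L).getD i [] = g.L.map (fun rj => dotAcc (getRow g.L i) rj 0) := by
    have hi' : i < g.L.length := hn ▸ hi
    simp only [gramRows, getRow, List.getD_eq_getElem?_getD, List.getElem?_map]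
    rw [List.getElem?_eq_getElem hi']
    simp
  rw [hrow, eval]
  have hlen2 : (g.L.map fun rj => dotAcc (getRow g.L i) rj 0).length = g.z.length := by simp [hn]
  rw [sum_map_zipWith _ _ (0 : ℤ) ⟨0, 0, 0⟩ _ _ hlen2, hlen2]
  refine Finset.sum_congr rfl fun j hj => ?_
  rw [Finset.mem_range] at hj
  have hj' : j < g.L.length := hn ▸ hj
  have hcol : (g.L.map fun rj => dotAcc (getRow g.L i) rj 0).getD j 0 = dotL (getRow g.L i) (getRow g.L j) := by
    simp only [getRow, List.getD_eq_getElem?_getD, List.getElem?_map]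
    rw [List.getElem?_eq_getElem hj']
    simp [dotAcc_eq]
  rw [hcol, Mono.eval_mul, getMono, getMono]

/-- `zᵀ (L Lᵀ) z ≥ 0`. [folklore] -/
theorem eval_quadL_nonneg (g : GramBlk) (h : g.lenOK = true) (u v t : ℝ) : 0 ≤ eval (quadL g) u v t := by
  set n := g.z.length
  set m := maxLen g.L
  have hlen : ∀ i, (getRow g.L i).length ≤ m := fun i => length_getRow_le g.L i
  rw [eval_quadL g h]
  set zz : ℕ → ℝ := fun i => (getMono g.z i).eval u v t
  set Lr : ℕ → ℕ → ℝ := fun i c => ((getRow g.L i).getD c 0 : ℝ)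
  have hentry : ∀ i j : ℕ, (dotL (getRow g.L i) (getRow g.L j) : ℝ) = ∑ c ∈ Finset.range m, Lr i c * Lr j c := by
    intro i j
    rw [dotL_eq_sum _ _ m (hlen i) (hlen j)]
    simp only [Lr, Int.cast_sum, Int.cast_mul]
  calc (0 : ℝ) ≤ ∑ c ∈ Finset.range m, (∑ i ∈ Finset.range n, Lr i c * zz i) ^ 2 :=
        Finset.sum_nonneg fun c _ => sq_nonneg _
    _ = ∑ i ∈ Finset.range n, ∑ j ∈ Finset.range n,
          (dotL (getRow g.L i) (getRow g.L j) : ℝ) * (zz i * zz j) := by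
        rw [Finset.sum_congr rfl fun i _ => Finset.sum_congr rfl fun j _ => by rw [hentry i j]]
        rw [Finset.sum_comm]
        simp only [sq, Finset.sum_mul, Finset.mul_sum]
        rw [Finset.sum_comm]
        refine Finset.sum_congr rfl fun i _ => ?_
        rw [Finset.sum_comm]
        refine Finset.sum_congr rfl fun j _ => Finset.sum_congr rfl fun c _ => ?_
        ring

/-! ### Row-chunked evaluation of the Gram quadratic form (bounded kernel memory per chunk) -/

/-- The value of one row of the quadratic form. [folklore] -/
def rowVal (g : GramBlk) (u v t : ℝ) (i : ℕ) : ℝ :=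
  ∑ j ∈ Finset.range g.z.length, (dotL (getRow g.L i) (getRow g.L j) : ℝ) *
    ((getMono g.z i).eval u v t * (getMono g.z j).eval u v t)

/-- Value of the inner row list. [folklore] -/
theorem eval_rowList (g : GramBlk) (hn : g.L.length = g.z.length) (u v t : ℝ) (i : ℕ) :
    eval (List.zipWith (fun (g' : ℤ) (zj : Mono) => ((getMono g.z i).mul zj, g'))
      (g.L.map fun rj => dotAcc (getRow g.L i) rj 0) g.z) u v t = rowVal g u v t i := by
  rw [eval, rowVal]
  have hlen2 : (g.L.map fun rj => dotAcc (getRow g.L i) rj 0).length = g.z.length := by simp [hn]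
  rw [sum_map_zipWith _ _ (0 : ℤ) ⟨0, 0, 0⟩ _ _ hlen2, hlen2]
  refine Finset.sum_congr rfl fun j hj => ?_
  rw [Finset.mem_range] at hj
  have hj' : j < g.L.length := hn ▸ hj
  have hcol : (g.L.map fun rj => dotAcc (getRow g.L i) rj 0).getD j 0 = dotL (getRow g.L i) (getRow g.L j) := by
    simp only [getRow, List.getD_eq_getElem?_getD, List.getElem?_map]
    rw [List.getElem?_eq_getElem hj']
    simp [dotAcc_eq]
  rw [hcol, Mono.eval_mul, getMono, getMono]

/-- `quadRows` evaluates to the sum of the row values over the chunk. [folklore] -/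
theorem eval_quadRows (g : GramBlk) (h : g.lenOK = true) (i0 cnt : ℕ) (hc : i0 + cnt ≤ g.z.length)
    (u v t : ℝ) : eval (quadRows g i0 cnt) u v t = ∑ i ∈ Finset.Ico i0 (i0 + cnt), rowVal g u v t i := by
  have hn : g.L.length = g.z.length := by simpa [GramBlk.lenOK] using h
  rw [quadRows, eval_mergeAllB]
  have hl1 : ((g.L.drop i0).take cnt).length = cnt := by
    rw [List.length_take, List.length_drop]; omega
  have hl2 : ((g.z.drop i0).take cnt).length = cnt := by
    rw [List.length_take, List.length_drop]; omega
  rw [sum_map_zipWith _ _ [] ⟨0, 0, 0⟩ _ _ (hl1.trans hl2.symm), hl1, Finset.sum_Ico_eq_sum_range,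
    show i0 + cnt - i0 = cnt by omega]
  refine Finset.sum_congr rfl fun r hr => ?_
  rw [Finset.mem_range] at hr
  have hrow : ((g.L.drop i0).take cnt).getD r [] = getRow g.L (i0 + r) := by
    rw [getRow, List.getD_eq_getElem?_getD, List.getD_eq_getElem?_getD, List.getElem?_take,
      if_pos hr, List.getElem?_drop]
  have hz : ((g.z.drop i0).take cnt).getD r ⟨0, 0, 0⟩ = getMono g.z (i0 + r) := by
    rw [getMono, List.getD_eq_getElem?_getD, List.getD_eq_getElem?_getD, List.getElem?_take,
      if_pos hr, List.getElem?_drop]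
  rw [hrow, hz, eval_rowList g hn u v t (i0 + r)]

/-- The full form is the sum of all rows. [folklore] -/
theorem eval_quadL_eq_sum_rowVal (g : GramBlk) (h : g.lenOK = true) (u v t : ℝ) :
    eval (quadL g) u v t = ∑ i ∈ Finset.range g.z.length, rowVal g u v t i := by
  rw [eval_quadL g h]; rfl

/-- Soundness of a chunk check. [folklore] -/
theorem eval_of_chunkOK (g : GramBlk) (i0 cnt : ℕ) (Dprev Dnext : SPoly)
    (h : chunkOK g i0 cnt Dprev Dnext = true) (u v t : ℝ) (hu : |u| ≤ 1) (hv : |v| ≤ 1) (ht : |t| ≤ 1) :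
    eval Dnext u v t = eval Dprev u v t + ∑ i ∈ Finset.Ico i0 (i0 + cnt), rowVal g u v t i := by
  simp only [chunkOK, Bool.and_eq_true, decide_eq_true_eq] at h
  obtain ⟨⟨hlen, hc⟩, hres⟩ := h
  have h0 := abs_eval_le_of_residualBound _ _ hres hu hv ht
  rw [eval_append, eval_append, eval_neg, eval_quadRows g hlen i0 cnt hc] at h0
  have h1 : |Dprev.eval u v t + ∑ i ∈ Finset.Ico i0 (i0 + cnt), rowVal g u v t i + -Dnext.eval u v t| ≤ 0 := by
    simpa using h0
  have h2 := abs_nonpos_iff.1 h1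
  linarith

/-- A Gram block validated in three row chunks: `R ≡ zᵀ(LLᵀ)z`. [folklore] -/
def QuadOK3 (g : GramBlk) (R : SPoly) : Prop :=
  ∃ (c1 c2 : ℕ) (D1 D2 : SPoly), c1 + c2 ≤ g.z.length ∧
    chunkOK g 0 c1 [] D1 = true ∧ chunkOK g c1 c2 D1 D2 = true ∧
    chunkOK g (c1 + c2) (g.z.length - (c1 + c2)) D2 R = true

/-- A validated Gram block is nonnegative on the box. [folklore] -/
theorem eval_R_nonneg_of_quadOK3 (g : GramBlk) (R : SPoly) (h : QuadOK3 g R) (u v t : ℝ)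
    (hu : |u| ≤ 1) (hv : |v| ≤ 1) (ht : |t| ≤ 1) : 0 ≤ eval R u v t := by
  obtain ⟨c1, c2, D1, D2, hc, h1, h2, h3⟩ := h
  have hlen : g.lenOK = true := by
    simp only [chunkOK, Bool.and_eq_true] at h1; exact h1.1.1
  have e1 := eval_of_chunkOK g 0 c1 [] D1 h1 u v t hu hv ht
  have e2 := eval_of_chunkOK g c1 c2 D1 D2 h2 u v t hu hv ht
  have e3 := eval_of_chunkOK g (c1 + c2) (g.z.length - (c1 + c2)) D2 R h3 u v t hu hv ht
  rw [eval_nil, zero_add, Nat.zero_add] at e1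
  have hsum : eval R u v t = ∑ i ∈ Finset.range g.z.length, rowVal g u v t i := by
    rw [e3, e2, e1, Finset.sum_Ico_consecutive _ (Nat.zero_le c1) (Nat.le_add_right c1 c2),
      Finset.sum_Ico_consecutive _ (Nat.zero_le _) (by omega : c1 + c2 ≤ c1 + c2 + (g.z.length - (c1 + c2))),
      show c1 + c2 + (g.z.length - (c1 + c2)) = g.z.length by omega, Finset.range_eq_Ico]
  rw [hsum, ← eval_quadL_eq_sum_rowVal g hlen]
  exact eval_quadL_nonneg g hlen u v t

/-- `eval ptU = (1+u)(1-2u)`. [folklore] -/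
@[simp] theorem eval_ptU (u v t : ℝ) : eval ptU u v t = (1 + u) * (1 - 2 * u) := by
  simp [ptU, eval, Mono.eval]; ring
/-- `eval ptV = (1+v)(1-2v)`. [folklore] -/
@[simp] theorem eval_ptV (u v t : ℝ) : eval ptV u v t = (1 + v) * (1 - 2 * v) := by
  simp [ptV, eval, Mono.eval]; ring
/-- `eval ptT = (1+t)(1-2t)`. [folklore] -/
@[simp] theorem eval_ptT (u v t : ℝ) : eval ptT u v t = (1 + t) * (1 - 2 * t) := by
  simp [ptT, eval, Mono.eval]; ring
/-- `eval p4 = 1 + 2uvt - u² - v² - t²`. [folklore] -/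
@[simp] theorem eval_p4 (u v t : ℝ) :
    eval p4 u v t = 1 + 2 * u * v * t - u ^ 2 - v ^ 2 - t ^ 2 := by
  simp [p4, eval, Mono.eval]; ring

/-- Two term lists with `residualBound (p ++ neg q) 0` agree on the unit box. [folklore] -/
theorem eval_eq_of_residual0 (p q : SPoly) (h : residualBound (p ++ neg q) 0 = true) (u v t : ℝ)
    (hu : |u| ≤ 1) (hv : |v| ≤ 1) (ht : |t| ≤ 1) : eval p u v t = eval q u v t := by
  have h0 := abs_eval_le_of_residualBound _ _ h hu hv ht
  rw [eval_append, eval_neg] at h0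
  have : |eval p u v t - eval q u v t| ≤ 0 := by simpa [sub_eq_add_neg] using h0
  have := abs_nonpos_iff.1 this
  linarith

/-- A validated `F` expansion evaluates to `Fval` on the box. [folklore] -/
theorem eval_FP_of_ok (F : List FBlk) (FP : SPoly) (h : FexpOK F FP = true) (u v t : ℝ)
    (hu : |u| ≤ 1) (hv : |v| ≤ 1) (ht : |t| ≤ 1) : eval FP u v t = Fval F u v t := by
  rw [← eval_FPoly]; exact (eval_eq_of_residual0 _ _ h u v t hu hv ht).symm

/-- Semantic validity of an `F` expansion: `FP = F` on the unit box (this is what the soundness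
theorems consume; it is established by `FexpOK` in one kernel computation, or block-chunked by
`fexpValid_of_chunks`). [folklore] -/
def FexpValid (F : List FBlk) (FP : SPoly) : Prop :=
  ∀ u v t : ℝ, |u| ≤ 1 → |v| ≤ 1 → |t| ≤ 1 → eval FP u v t = Fval F u v t

/-- `FexpOK` implies validity. [folklore] -/
theorem fexpValid_of_ok (F : List FBlk) (FP : SPoly) (h : FexpOK F FP = true) : FexpValid F FP :=
  fun u v t hu hv ht => eval_FP_of_ok F FP h u v t hu hv ht

/-- `Fval` is additive in the block list. [folklore] -/
theorem Fval_append (l₁ l₂ : List FBlk) (u v t : ℝ) :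
    Fval (l₁ ++ l₂) u v t = Fval l₁ u v t + Fval l₂ u v t := by
  simp [Fval, List.map_append, List.sum_append]

/-- Soundness of a block-chunk check. [folklore] -/
theorem eval_of_FchunkOK (bs : List FBlk) (Dprev Dnext : SPoly) (h : FchunkOK bs Dprev Dnext = true)
    (u v t : ℝ) (hu : |u| ≤ 1) (hv : |v| ≤ 1) (ht : |t| ≤ 1) :
    eval Dnext u v t = eval Dprev u v t + Fval bs u v t := by
  have h0 := abs_eval_le_of_residualBound _ _ h hu hv ht
  rw [eval_append, eval_append, eval_neg, eval_FPoly] at h0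
  have h1 : |Dprev.eval u v t + Fval bs u v t + -Dnext.eval u v t| ≤ 0 := by simpa using h0
  have h2 := abs_nonpos_iff.1 h1
  linarith

/-- Validity of an `F` expansion from three block chunks
(`F = F.take n₁ ++ (F.drop n₁).take n₂ ++ (F.drop n₁).drop n₂`). [folklore] -/
theorem fexpValid_of_chunks (F : List FBlk) (FP D1 D2 : SPoly) (n1 n2 : ℕ)
    (h1 : FchunkOK (F.take n1) [] D1 = true) (h2 : FchunkOK ((F.drop n1).take n2) D1 D2 = true)
    (h3 : FchunkOK ((F.drop n1).drop n2) D2 FP = true) : FexpValid F FP := by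
  intro u v t hu hv ht
  have e1 := eval_of_FchunkOK _ _ _ h1 u v t hu hv ht
  have e2 := eval_of_FchunkOK _ _ _ h2 u v t hu hv ht
  have e3 := eval_of_FchunkOK _ _ _ h3 u v t hu hv ht
  rw [eval_nil, zero_add] at e1
  have f1 : Fval F u v t = Fval (F.take n1) u v t + Fval (F.drop n1) u v t := by
    rw [← Fval_append, List.take_append_drop]
  have f2 : Fval (F.drop n1) u v t = Fval ((F.drop n1).take n2) u v t + Fval ((F.drop n1).drop n2) u v t := by
    rw [← Fval_append, List.take_append_drop]
  rw [e3, e2, e1, f1, f2]; ring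

/-- A validated Gram expansion is nonnegative on the box. [folklore] -/
theorem eval_R_nonneg_of_ok (g : GramBlk) (R : SPoly) (h : quadExpOK g R = true) (u v t : ℝ)
    (hu : |u| ≤ 1) (hv : |v| ≤ 1) (ht : |t| ≤ 1) : 0 ≤ eval R u v t := by
  simp only [quadExpOK, Bool.and_eq_true] at h
  rw [← eval_eq_of_residual0 _ _ h.2 u v t hu hv ht]; exact eval_quadL_nonneg g h.1 u v t

/-- A block validated in a single chunk (`c1 = n`, `D1 = D2 = R`). [folklore] -/
theorem quadOK3_of_single (g : GramBlk) (R : SPoly) (h1 : chunkOK g 0 g.z.length [] R = true)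
    (h2 : chunkOK g g.z.length 0 R R = true) (h3 : chunkOK g (g.z.length + 0) (g.z.length - (g.z.length + 0)) R R = true) :
    QuadOK3 g R :=
  ⟨g.z.length, 0, R, R, by omega, h1, h2, h3⟩

/-- A block validated in three chunks. [folklore] -/
theorem quadOK3_of_chunks (g : GramBlk) (R D1 D2 : SPoly) (c1 c2 : ℕ) (hc : c1 + c2 ≤ g.z.length)
    (h1 : chunkOK g 0 c1 [] D1 = true) (h2 : chunkOK g c1 c2 D1 D2 = true)
    (h3 : chunkOK g (c1 + c2) (g.z.length - (c1 + c2)) D2 R = true) : QuadOK3 g R :=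
  ⟨c1, c2, D1, D2, hc, h1, h2, h3⟩

/-- Validity of the polynomial data with respect to the Gram blocks and `F`. [folklore] -/
structure PolysOK (c : Cert) (P : CertPolys) (r ru rv rt r4 q q1 : GramBlk) : Prop where
  /-- `F` expansion valid (on the box) -/
  hF : FexpValid c.F P.FP
  /-- Gram expansion of `r` valid (row-chunked) -/
  hr : QuadOK3 r P.Rr
  /-- Gram expansion of `r_u` valid -/
  hu : QuadOK3 ru P.Ru
  /-- Gram expansion of `r_v` valid -/
  hv : QuadOK3 rv P.Rv
  /-- Gram expansion of `r_t` valid -/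
  ht : QuadOK3 rt P.Rt
  /-- Gram expansion of `r_4` valid -/
  h4 : QuadOK3 r4 P.R4
  /-- Gram expansion of `q` valid -/
  hq : QuadOK3 q P.Qq
  /-- Gram expansion of `q_1` valid -/
  hq1 : QuadOK3 q1 P.Qq1

set_option maxHeartbeats 4000000 in
/-- Soundness of `(ii')`. [folklore] -/
theorem FII_of_check (c : Cert) (P : CertPolys) {r ru rv rt r4 q q1 : GramBlk}
    (hP : PolysOK c P r ru rv rt r4 q q1) (h : checkII c P = true) (hs : checkSide c = true)
    (u v t : ℝ)
    (hu : -1 ≤ u) (hu' : u ≤ 1 / 2) (hv : -1 ≤ v) (hv' : v ≤ 1 / 2) (ht : -1 ≤ t) (ht' : t ≤ 1 / 2)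
    (hp : 0 ≤ 1 + 2 * u * v * t - u ^ 2 - v ^ 2 - t ^ 2) :
    Fval c.F u v t / 4 ^ c.Sp ≤ -(c.B22 / 2 ^ c.S) := by
  have hu1 : |u| ≤ 1 := abs_le.2 ⟨hu, by linarith⟩
  have hv1 : |v| ≤ 1 := abs_le.2 ⟨hv, by linarith⟩
  have ht1 : |t| ≤ 1 := abs_le.2 ⟨ht, by linarith⟩
  have hres := abs_eval_le_of_residualBound _ _ h hu1 hv1 ht1
  rw [eval_mergeAll] at hres
  simp only [List.map_cons, List.map_nil, List.sum_cons, List.sum_nil, add_zero, eval_neg, eval_C,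
    Int.cast_natCast] at hres
  have hrhs : 0 ≤ eval (rhsII P) u v t := by
    have h0 := eval_R_nonneg_of_quadOK3 r P.Rr hP.hr u v t hu1 hv1 ht1
    have h1 := eval_R_nonneg_of_quadOK3 ru P.Ru hP.hu u v t hu1 hv1 ht1
    have h2 := eval_R_nonneg_of_quadOK3 rv P.Rv hP.hv u v t hu1 hv1 ht1
    have h3 := eval_R_nonneg_of_quadOK3 rt P.Rt hP.ht u v t hu1 hv1 ht1
    have h4 := eval_R_nonneg_of_quadOK3 r4 P.R4 hP.h4 u v t hu1 hv1 ht1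
    rw [rhsII, eval_mergeAll]
    simp only [List.map_cons, List.map_nil, List.sum_cons, List.sum_nil, add_zero, eval_mulN,
      eval_ptU, eval_ptV, eval_ptT, eval_p4]
    generalize eval P.Rr u v t = q0 at *
    generalize eval P.Ru u v t = q1' at *
    generalize eval P.Rv u v t = q2 at *
    generalize eval P.Rt u v t = q3 at *
    generalize eval P.R4 u v t = q4 at *
    have m1 : 0 ≤ (1 + u) * (1 - 2 * u) := mul_nonneg (by linarith) (by linarith)
    have m2 : 0 ≤ (1 + v) * (1 - 2 * v) := mul_nonneg (by linarith) (by linarith)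
    have m3 : 0 ≤ (1 + t) * (1 - 2 * t) := mul_nonneg (by linarith) (by linarith)
    linarith [mul_nonneg m1 h1, mul_nonneg m2 h2, mul_nonneg m3 h3, mul_nonneg hp h4]
  generalize hR : eval (rhsII P) u v t = R at hres hrhs
  generalize hT : eval (targetII c P) u v t = T at hres
  have hT0 : 0 ≤ T := by
    have h1 := (abs_le.1 hres).1
    linarith
  have htgt : 0 ≤ eval (targetII c P) u v t := hT ▸ hT0
  rw [targetII, eval_neg, eval_append, eval_C, eval_smul, hP.hF u v t hu1 hv1 ht1]
    at htgt
  push_cast at htgt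
  generalize hF : Fval c.F u v t = FV at htgt ⊢
  have hXY : (2 : ℝ) ^ (2 * c.Spp - c.S) * (c.B22 : ℝ) + 2 ^ (2 * c.Spp - 2 * c.Sp) * FV ≤ 0 :=
    neg_nonneg.1 htgt
  have key : (2 : ℝ) ^ (2 * c.Spp - 2 * c.Sp) * FV ≤ -((2 : ℝ) ^ (2 * c.Spp - c.S) * c.B22) :=
    le_neg_iff_add_nonpos_left.2 hXY
  simp only [checkSide, Bool.and_eq_true, decide_eq_true_eq] at hs
  obtain ⟨⟨⟨⟨⟨⟨hS, hSp⟩, _⟩, _⟩, _⟩, _⟩, _⟩ := hs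
  have two_pos' : (0 : ℝ) < 2 := by norm_num
  have four_pos' : (0 : ℝ) < 4 := by norm_num
  have hexp1 : 2 * c.Spp - c.S + c.S = 2 * c.Spp := by omega
  have hexp2 : 2 * c.Spp - 2 * c.Sp + 2 * c.Sp = 2 * c.Spp := by omega
  have e1 : (2 : ℝ) ^ (2 * c.Spp - c.S) * 2 ^ c.S = 2 ^ (2 * c.Spp) := by
    rw [← pow_add, hexp1]
  have e2 : (2 : ℝ) ^ (2 * c.Spp - 2 * c.Sp) * 4 ^ c.Sp = 2 ^ (2 * c.Spp) := by
    rw [show (4 : ℝ) = 2 ^ 2 by norm_num, ← pow_mul, ← pow_add, hexp2]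
  have hpa : (0 : ℝ) < 2 ^ (2 * c.Spp - 2 * c.Sp) := pow_pos two_pos' _
  have hpb : (0 : ℝ) < 2 ^ (2 * c.Spp - c.S) := pow_pos two_pos' _
  have hden : (0 : ℝ) ≤ 2 ^ (2 * c.Spp - 2 * c.Sp) * 4 ^ c.Sp :=
    (mul_pos hpa (pow_pos four_pos' _)).le
  calc FV / 4 ^ c.Sp
      = (2 ^ (2 * c.Spp - 2 * c.Sp) * FV) / (2 ^ (2 * c.Spp - 2 * c.Sp) * 4 ^ c.Sp) := by
        rw [mul_div_mul_left _ _ hpa.ne']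
    _ ≤ -((2 : ℝ) ^ (2 * c.Spp - c.S) * c.B22) / (2 ^ (2 * c.Spp - 2 * c.Sp) * 4 ^ c.Sp) :=
        div_le_div_of_nonneg_right key hden
    _ = -((2 : ℝ) ^ (2 * c.Spp - c.S) * c.B22) / (2 ^ (2 * c.Spp - c.S) * 2 ^ c.S) := by rw [e2, ← e1]
    _ = -(c.B22 / 2 ^ c.S) := by rw [neg_div, mul_div_mul_left _ _ hpb.ne']

set_option maxHeartbeats 4000000 in
/-- Soundness of `(i')`. [folklore] -/
theorem AF_of_check (c : Cert) (P : CertPolys) {r ru rv rt r4 q q1 : GramBlk}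
    (hP : PolysOK c P r ru rv rt r4 q q1) (h : checkI c P = true) (hs : checkSide c = true) (s : ℝ)
    (hs1 : -1 ≤ s) (hs2 : s ≤ 1 / 2) :
    Aval c.A s / 2 ^ c.S + 3 * (Fval c.F s s 1 / 4 ^ c.Sp) ≤
      -1 - 2 * (c.B12 / 2 ^ c.S) - c.B22 / 2 ^ c.S := by
  have hu1 : |s| ≤ 1 := abs_le.2 ⟨hs1, by linarith⟩
  have h01 : |(0 : ℝ)| ≤ 1 := by norm_num
  have h11 : |(1 : ℝ)| ≤ 1 := by norm_num
  have hres := abs_eval_le_of_residualBound _ _ h hu1 h01 h01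
  rw [eval_mergeAll] at hres
  simp only [List.map_cons, List.map_nil, List.sum_cons, List.sum_nil, add_zero, eval_neg, eval_C,
    Int.cast_natCast] at hres
  have hrhs : 0 ≤ eval (rhsI P) s 0 0 := by
    have h0 := eval_R_nonneg_of_quadOK3 q P.Qq hP.hq s 0 0 hu1 h01 h01
    have h1 := eval_R_nonneg_of_quadOK3 q1 P.Qq1 hP.hq1 s 0 0 hu1 h01 h01
    rw [rhsI, eval_mergeAll]
    simp only [List.map_cons, List.map_nil, List.sum_cons, List.sum_nil, add_zero, eval_mulN,
      eval_ptU]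
    generalize eval P.Qq s 0 0 = q0 at *
    generalize eval P.Qq1 s 0 0 = q1' at *
    have m1 : 0 ≤ (1 + s) * (1 - 2 * s) := mul_nonneg (by linarith) (by linarith)
    linarith [mul_nonneg m1 h1]
  generalize hR : eval (rhsI P) s 0 0 = R at hres hrhs
  generalize hT : eval (targetI c P) s 0 0 = T at hres
  have hT0 : 0 ≤ T := by
    have h1 := (abs_le.1 hres).1
    linarith
  have htgt : 0 ≤ eval (targetI c P) s 0 0 := hT ▸ hT0
  have hFss : eval (substUU1 P.FP) s 0 0 = Fval c.F s s 1 := by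
    rw [eval_substUU1, hP.hF s s 1 hu1 hu1 h11]
  rw [targetI, eval_neg, eval_append, eval_append, eval_append, eval_C, eval_smul, eval_APoly,
    eval_C, eval_smul, hFss] at htgt
  push_cast at htgt
  generalize hF : Fval c.F s s 1 = FV at htgt ⊢
  generalize hA : Aval c.A s = AV at htgt ⊢
  simp only [checkSide, Bool.and_eq_true, decide_eq_true_eq] at hs
  obtain ⟨⟨⟨⟨⟨⟨hS, hSp⟩, _⟩, _⟩, _⟩, _⟩, _⟩ := hs
  have two_pos' : (0 : ℝ) < 2 := by norm_num
  have four_pos' : (0 : ℝ) < 4 := by norm_num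
  have hexp1 : 2 * c.Spp - c.S + c.S = 2 * c.Spp := by omega
  have hexp2 : 2 * c.Spp - 2 * c.Sp + 2 * c.Sp = 2 * c.Spp := by omega
  have e1 : (2 : ℝ) ^ (2 * c.Spp - c.S) * 2 ^ c.S = 2 ^ (2 * c.Spp) := by
    rw [← pow_add, hexp1]
  have e2 : (2 : ℝ) ^ (2 * c.Spp - 2 * c.Sp) * 4 ^ c.Sp = 2 ^ (2 * c.Spp) := by
    rw [show (4 : ℝ) = 2 ^ 2 by norm_num, ← pow_mul, ← pow_add, hexp2]
  have hpa : (0 : ℝ) < 2 ^ (2 * c.Spp - 2 * c.Sp) := pow_pos two_pos' _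
  have hpb : (0 : ℝ) < 2 ^ (2 * c.Spp - c.S) := pow_pos two_pos' _
  have hpc : (0 : ℝ) < 2 ^ (2 * c.Spp) := pow_pos two_pos' _
  have key : (2 : ℝ) ^ (2 * c.Spp - c.S) * AV + 3 * 2 ^ (2 * c.Spp - 2 * c.Sp) * FV ≤
      -(2 ^ (2 * c.Spp)) - 2 ^ (2 * c.Spp - c.S) * (2 * c.B12 + c.B22) := by
    have := neg_nonneg.1 htgt
    linarith
  have hdiv := div_le_div_of_nonneg_right key hpc.le
  have p1 : (2 : ℝ) ^ (2 * c.Spp - c.S) * AV / 2 ^ (2 * c.Spp) = AV / 2 ^ c.S := by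
    rw [← e1, mul_div_mul_left _ _ hpb.ne']
  have p2 : (3 : ℝ) * 2 ^ (2 * c.Spp - 2 * c.Sp) * FV / 2 ^ (2 * c.Spp) = 3 * (FV / 4 ^ c.Sp) := by
    rw [← e2, mul_assoc, mul_div_assoc, mul_div_mul_left _ _ hpa.ne']
  have lhs_eq : ((2 : ℝ) ^ (2 * c.Spp - c.S) * AV + 3 * 2 ^ (2 * c.Spp - 2 * c.Sp) * FV) / 2 ^ (2 * c.Spp)
      = AV / 2 ^ c.S + 3 * (FV / 4 ^ c.Sp) := by
    rw [add_div, p1, p2]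
  have rhs_eq : (-(2 : ℝ) ^ (2 * c.Spp) - 2 ^ (2 * c.Spp - c.S) * (2 * c.B12 + c.B22)) / 2 ^ (2 * c.Spp)
      = -1 - 2 * (c.B12 / 2 ^ c.S) - c.B22 / 2 ^ c.S := by
    rw [sub_div, neg_div, div_self hpc.ne', ← e1, mul_div_mul_left _ _ hpb.ne']
    ring
  rw [lhs_eq, rhs_eq] at hdiv
  exact hdiv

/-- The `b`-matrix is positive semidefinite as a quadratic. [folklore] -/
theorem bquad_nonneg_of_check (c : Cert) (hs : checkSide c = true) (l : ℝ) :
    0 ≤ c.B11 / 2 ^ c.S + 2 * (c.B12 / 2 ^ c.S) * l + c.B22 / 2 ^ c.S * l ^ 2 := by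
  simp only [checkSide, Bool.and_eq_true, decide_eq_true_eq] at hs
  obtain ⟨⟨⟨_, h11⟩, h22⟩, hdet⟩ := hs
  have h11' : (0 : ℝ) ≤ c.B11 := by exact_mod_cast h11
  have h22' : (0 : ℝ) < c.B22 := by exact_mod_cast h22
  have hdet' : (c.B12 : ℝ) * c.B12 ≤ c.B11 * c.B22 := by exact_mod_cast hdet
  have h2S : (0 : ℝ) < 2 ^ c.S := pow_pos (by norm_num) _
  have hq : 0 ≤ (c.B11 : ℝ) + 2 * c.B12 * l + c.B22 * l ^ 2 := by
    have hmul : 0 ≤ (c.B22 : ℝ) * (c.B11 + 2 * c.B12 * l + c.B22 * l ^ 2) := by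
      nlinarith [sq_nonneg ((c.B22 : ℝ) * l + c.B12)]
    exact nonneg_of_mul_nonneg_right (by linarith [hmul]) h22'
  have : (c.B11 : ℝ) / 2 ^ c.S + 2 * (c.B12 / 2 ^ c.S) * l + c.B22 / 2 ^ c.S * l ^ 2 =
      (c.B11 + 2 * c.B12 * l + c.B22 * l ^ 2) / 2 ^ c.S := by
    field_simp
  rw [this]
  exact div_nonneg hq h2S.le

/-- **The bound from a checked certificate** (Bachoc–Vallentin Thm 4.2 instantiated):
`|C| ≤ 1 + A(1) + b₁₁ + F(1,1,1)` for every `π/3`-code on `S³`. [cite: BachocVallentin2007, Theorem 4.2] -/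
theorem card_le_of_cert (c : Cert) (P : CertPolys) {r ru rv rt r4 q q1 : GramBlk}
    (hP : PolysOK c P r ru rv rt r4 q q1) (hI : checkI c P = true) (hII : checkII c P = true)
    (hs : checkSide c = true)
    (hpos : 0 ≤ 1 + Aval c.A 1 / 2 ^ c.S + c.B11 / 2 ^ c.S + Fval c.F 1 1 1 / 4 ^ c.Sp)
    (C : Finset E⁴) (hC : ∀ x ∈ C, ‖x‖ = 1)
    (hcode : ∀ x ∈ C, ∀ y ∈ C, x ≠ y → inner ℝ x y ≤ 1 / 2) :
    (C.card : ℝ) ≤ 1 + Aval c.A 1 / 2 ^ c.S + c.B11 / 2 ^ c.S + Fval c.F 1 1 1 / 4 ^ c.Sp := by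
  have hs' := hs
  simp only [checkSide, Bool.and_eq_true, decide_eq_true_eq, List.all_eq_true] at hs'
  obtain ⟨⟨⟨⟨⟨⟨hS, hSp⟩, hlen⟩, hApos⟩, h11⟩, h22⟩, hdet⟩ := hs'
  have h2S : (0 : ℝ) < 2 ^ c.S := pow_pos (by norm_num) _
  have h4S : (0 : ℝ) < 4 ^ c.Sp := pow_pos (by norm_num) _
  have hApos' : ∀ k, 0 ≤ c.A.getD k 0 := by
    intro k
    simp only [List.getD_eq_getElem?_getD]
    cases h : c.A[k]? with
    | none => simp
    | some a => simpa using hApos a (List.mem_iff_getElem?.2 ⟨k, h⟩)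
  have hA : 0 ≤ pairSum C (fun u => Aval c.A u / 2 ^ c.S) := by
    have h0 := pairSum_Aval_nonneg c.A hlen hApos' C hC
    unfold pairSum at h0 ⊢
    have e : (∑ x ∈ C, ∑ y ∈ C, Aval c.A (inner ℝ x y) / 2 ^ c.S) =
        (∑ x ∈ C, ∑ y ∈ C, Aval c.A (inner ℝ x y)) / 2 ^ c.S := by
      rw [Finset.sum_div]; refine Finset.sum_congr rfl fun x _ => ?_; rw [Finset.sum_div]
    rw [e]; exact div_nonneg h0 h2S.le
  have hF : 0 ≤ tripleSum C (fun u v t => Fval c.F u v t / 4 ^ c.Sp) := by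
    have h0 := tripleSum_Fval_nonneg c.F C hC
    unfold tripleSum at *
    have : (∑ x ∈ C, ∑ y ∈ C, ∑ z ∈ C, Fval c.F (inner ℝ x y) (inner ℝ x z) (inner ℝ y z) / 4 ^ c.Sp)
        = (∑ x ∈ C, ∑ y ∈ C, ∑ z ∈ C, Fval c.F (inner ℝ x y) (inner ℝ x z) (inner ℝ y z)) / 4 ^ c.Sp := by
      rw [Finset.sum_div]; refine Finset.sum_congr rfl fun x _ => ?_
      rw [Finset.sum_div]; refine Finset.sum_congr rfl fun y _ => ?_
      rw [Finset.sum_div]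
    rw [this]
    exact div_nonneg h0 h4S.le
  refine card_le_of_threePoint C hC hcode (fun u => Aval c.A u / 2 ^ c.S)
    (fun u v t => Fval c.F u v t / 4 ^ c.Sp) (c.B11 / 2 ^ c.S) (c.B12 / 2 ^ c.S) (c.B22 / 2 ^ c.S)
    hA hF ?_ ?_ (bquad_nonneg_of_check c hs) ?_ ?_ hpos
  · intro u v t; rw [Fval_swap12]
  · intro u v t; rw [Fval_swap23]
  · intro s hs1 hs2; exact AF_of_check c P hP hI hs s hs1 hs2
  · intro u v t hu hu' hv hv' ht ht' hp; exact FII_of_check c P hP hII hs u v t hu hu' hv hv' ht ht' hp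

/-! ### The numerical value of the bound -/

/-- The bound is `< 25` and `≥ 0` when `checkBound` succeeds. [folklore] -/
theorem bound_of_check (c : Cert) (P : CertPolys) (hF : FexpValid c.F P.FP)
    (h : checkBound c P = true) :
    1 + Aval c.A 1 / 2 ^ c.S + c.B11 / 2 ^ c.S + Fval c.F 1 1 1 / 4 ^ c.Sp < 25 ∧
      0 ≤ 1 + Aval c.A 1 / 2 ^ c.S + c.B11 / 2 ^ c.S + Fval c.F 1 1 1 / 4 ^ c.Sp := by
  simp only [checkBound, Bool.and_eq_true, decide_eq_true_eq] at h
  obtain ⟨hlt, hge⟩ := h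
  have h11 : |(1 : ℝ)| ≤ 1 := by norm_num
  have hAv : Aval c.A 1 = (coeffSum (APoly c.A) : ℝ) := by
    rw [← eval_APoly c.A 1 1 1, eval_one_one_one]
  have hFv : Fval c.F 1 1 1 = (coeffSum P.FP : ℝ) := by
    rw [← hF 1 1 1 h11 h11 h11, eval_one_one_one]
  rw [hAv, hFv]
  generalize (coeffSum (APoly c.A)) = IA at *
  generalize (coeffSum P.FP) = IF at *
  have h2S : (0 : ℝ) < 2 ^ c.S := pow_pos (by norm_num) _
  have h4S : (0 : ℝ) < 4 ^ c.Sp := pow_pos (by norm_num) _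
  have hlt' : ((4 : ℝ) ^ c.Sp * (2 ^ c.S + IA + c.B11) + 2 ^ c.S * IF) < 25 * 2 ^ c.S * 4 ^ c.Sp := by
    exact_mod_cast hlt
  have hge' : (0 : ℝ) ≤ (4 : ℝ) ^ c.Sp * (2 ^ c.S + IA + c.B11) + 2 ^ c.S * IF := by
    exact_mod_cast hge
  have e : (1 : ℝ) + IA / 2 ^ c.S + c.B11 / 2 ^ c.S + IF / 4 ^ c.Sp =
      ((4 : ℝ) ^ c.Sp * (2 ^ c.S + IA + c.B11) + 2 ^ c.S * IF) / (2 ^ c.S * 4 ^ c.Sp) := by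
    field_simp
  rw [e]
  constructor
  · rw [div_lt_iff₀ (mul_pos h2S h4S)]; linarith
  · exact div_nonneg hge' (mul_pos h2S h4S).le

/-- **From a fully checked certificate to `k(4) ≤ 24`**: if the side conditions, the expansions,
the two polynomial checks and the numerical bound all pass, every finite set of unit vectors of
`ℝ⁴` with pairwise inner products `≤ 1/2` has at most `24` elements.
[cite: BachocVallentin2007, Theorem 4.2] -/
theorem card_le_24_of_cert (c : Cert) (P : CertPolys) {r ru rv rt r4 q q1 : GramBlk}
    (hP : PolysOK c P r ru rv rt r4 q q1) (hI : checkI c P = true) (hII : checkII c P = true)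
    (hs : checkSide c = true) (hb : checkBound c P = true)
    (C : Finset E⁴) (hC : ∀ x ∈ C, ‖x‖ = 1)
    (hcode : ∀ x ∈ C, ∀ y ∈ C, x ≠ y → inner ℝ x y ≤ 1 / 2) : C.card ≤ 24 := by
  have hbd := bound_of_check c P hP.hF hb
  have h := card_le_of_cert c P hP hI hII hs hbd.2 C hC hcode
  have hlt : (C.card : ℝ) < 25 := lt_of_le_of_lt h hbd.1
  have hlt' : C.card < 25 := by exact_mod_cast hlt
  omega

end PolyCert.SPoly

end Literature.Geometry.DiscreteGeometry

end
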